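import Summits.CriticalPhenomena.SAWScalingLimit.Theses.SAWLaplacianWalk
import Summits.CriticalPhenomena.SAWScalingLimit.Theses.SAWLoopFugacityFlow
import Summits.CriticalPhenomena.SAWScalingLimit.Theses.SAWTipEnvironment
import Literature.Probability.RandomPlanarGeometry.SimpleCurveLoewner

/-!
# Birth skeleton — crux `LimitsDescribable` (stmt-CriticalPhenomena-4481), route `SAWLaplacianWalk`

Crux (FIXED, concluded BY NAME by `LimitsDescribable_of`; rank 3 of
`route-CriticalPhenomena-SAWLaplacianWalk`, shared verbatim with `SAWTipEnvironment.LimitsDescribable`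
— the hypothesis shape of `HarmonicPassage` / `HarmonicIdentification`):

  `∀ D a b, SAW.IsEndpointApprox D a b → ∀ φ, D.IsChordalUniformizing φ →
     ∀ ν, IsProbabilityMeasure ν → IsSubseqLimitLaw (fun δ γ ↦ γ.curve) (fun δ ↦ SAW.law …) ν →
       ∀ᵐ c ∂ν, IsLoewnerDescribable φ c ∧ c.source = D.pt 0`

— every probability subsequential limit of the critical `δℤ²` SAW curve laws of `(D; a_δ, b_δ)`
is carried by curve classes from `a` that the Loewner evolution through `φ` describes
(Kemppainen–Smirnov 2017, Thm. 1.5 (ii) / Cor. 1.7, OUTPUT form).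

## The cut (two registered stubs): SIMPLE CHORDS + NO TANGENTIAL CREEP INTO THE TARGET

For a SIMPLE chord `c` of `(D; a, b)` (injective, `c 0 = a`, `c 1 = b`, `c(0, 1) ⊆ D`) the tree
PROVES Lawler's Prop. 4.4 through the chordal uniformizing map
(`MarkedDomain.IsChordalUniformizing.isLoewnerDescribable_mk_of_injOn`, `SimpleCurveLoewner.lean`):
`c` is Loewner-describable through `φ` as soon as its pull-back enters `∞` with diverging height,
`im φ⁻¹(c u) → ∞` (`u ↑ 1`) — and SOME divergence at `b` is necessary (Loewner hulls at finite
capacity are bounded, so a describable class has `hcap φ⁻¹(c(0, u]) → ∞`).  Hence, modulo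
simplicity of the limits, the crux IS a statement about the approach to the target, and the
skeleton registers exactly these two pieces:

* `stub_simpleChordalLimits` — **SIMPLE CHORDAL LIMITS** = the shared crux `SimpleSubseqLimits`
  (stmt-CriticalPhenomena-4982, route `SAWLoopFugacityFlow`) VERBATIM: along any `s n → 0⁺`, a
  probability weak limit `ν` of the pushed-forward SAW laws is carried by simple classes from `a`
  to `b` with range in `cl D` meeting `∂D` only at `a, b`.  Not re-filed: wiring check 3 feeds the
  route item ITSELF into the composition (`rfl`-typing).  Open; staffed there (live line
  `past-shadowing-costs-halves`: lattice ORDER + BOUNDARY estimates, all endpoint data incl. interior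
  roots); summit-necessary (landed `Theorems/SimpleSubseqLimits/Negative/SimpleSubseqLimitsNecessary`).
* `stub_targetHeightDivergence` — **NO TANGENTIAL CREEP INTO `b`** (new, limit-level, the
  describability content beyond simplicity): `ν`-a.e. class enters `b` through every horodisc —
  `∀ M, ∃ r > 0, ∀ z ∈ range ∩ D, dist z b < r → M < im φ⁻¹ z`.  For a chord ending at `b` this is
  literally the `hinf` of the tree's Prop. 4.4 (proved in the composition from `γ u → γ 1 = b`).
  Plausibility: for chordal SLE_{8/3} it holds a.s. (boundary-escape at dyadic scales: the trace
  enters `{2ᵏ ≤ |w| ≤ 2ᵏ⁺¹, im w ≤ M}` with probability `≲ M 2⁻ᵏ`, one-point boundary exponent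
  `8/κ − 1 = 2`, Borel–Cantelli), so the stub is summit-implied modulo that SLE fact; it is NOT
  crux-implied (the crux only forces `hcap`-divergence) — the honest over-strength is the gap
  between `im → ∞` and `hcap → ∞`, i.e. the form of Lawler's hypothesis the tree has.
  Kemppainen–Smirnov's name for the lattice-side input is transience at `b` (Prop. 3.2 (i), `N₀`).

## Why NOT the route's foreseen KS line (`Condition G2 ⇒ KS Thm 1.5`) — three recorded obstructions

The deterministic half of KS is in the tree AND the SAW plumbing is landed
(`Theorems/SAWLoopFugacityFlowSimpleSubseqLimitsStubDescribable`: `stub_describable_of_ksRegular`,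
`ae_isLoewnerDescribable_of_eventually_regular`, p100275), but its hypothesis `SAWKSRegularAlong`
(KS-regular through DETERMINISTIC approximating Dobrushin domains, for ALL endpoint data) cannot be a
stub: (i) the tree's `ConditionG2`/`unforcedPart` (polyline-slit convention `U ∖ past.range`) are
FALSE for SAW polylines (lattice-sealed pocket; `Cruxes/SimpleSubseqLimits/Lines/capacity-clock-no-plateau-dead.md`),
so the named fact `exists_regularity_of_conditionG2` cannot be fed; (ii) sup-over-past (G-type)
statements are false for floating starts / island pasts (`Cruxes/SimpleSubseqLimits/Disproof.lean`
§14 ring road; `Cruxes/EventualTight/LeadAnalysis-c1.md` A1/A2); (iii) `IsEndpointApprox` admits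
INTERIOR ROOTS `a_δ` at mesoscopic depth, around which the walk winds at vanishing scales, so no
deterministic approximating domain with `a_δ` on its boundary carries `1 − ε` of the mass — the
`∀ data` form of `SAWKSRegularAlong` is not a credible stub (the same root obstruction killed
`capacity-clock-no-plateau`).  The present cut is limit-level and blind to sub-mesoscopic winding.

## Composition (PROVED here, no `sorry`): `LimitsDescribable_of`

subsequential limit `ν` along `s` ⇒ (STUB 1) a.e. an injective representative `γ`, `γ 0 = a`,
`γ 1 = b`, `γ(0,1) ⊆ D` (a point of `γ(0,1)` on `∂D` would be `a = γ 0` or `b = γ 1`: injectivity;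
`cl D = D ∪ ∂D` as `D` is open) ⇒ (STUB 2 + continuity of `IccExtend γ` at `1`) `im φ⁻¹(γ u) → ∞` ⇒
(`isLoewnerDescribable_mk_of_injOn`) `IsLoewnerDescribable φ (mk γ)`; source clause from STUB 1 ⇒ the
crux BY NAME; the `SAWTipEnvironment` copy by the same term (wiring check 2).

## Calibration

* `ledger crux ls stmt-CriticalPhenomena-4481`: no `Disproof.lean`, no landed `Negative/*` for this
  crux (2026-08-17) — nothing to honour yet.  Negatives index (`ledger negatives`): the four
  `SAWScalingLimit` entries (all-δ `Tight` stmt-0772, `HexObservableLimit`, `InfiniteDivisibility`,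
  `RetrievalStability`) are unrelated to either stub.
* STUB 1 inherits the sibling's certificates: `SimpleSubseqLimitsFalseWithoutEndpointLimits`
  (endpoint limits are load-bearing — kept: both stubs carry `IsEndpointApprox`),
  `SimpleSubseqLimitsNecessary` (summit ⇒ STUB 1), `SimpleSubseqLimitsSimpleNotClosed` (simplicity is
  not a closed event — why STUB 1 is research-open and not portmanteau bookkeeping).
* Refuter/grounder notes on the item (2026-08-15): "source = a is automatic by portmanteau" — here it
  rides inside STUB 1 (its `source` clause), no separate stub.

## Audit record (planner skeleton-register, 2026-08-17)

* `lean check --json`: rc 0, errors [], `sorries = 2` = the two `stub_*` (no other `sorry`);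
  `#print axioms LimitsDescribable_of` = `[propext, Classical.choice, Quot.sound]`.
* `#h21_check_skeleton "stmt-CriticalPhenomena-4481" …SAWLaplacianWalk.LimitsDescribable
  stub_simpleChordalLimits stub_targetHeightDivergence`: `ok = true`, `codes = []`, theorem
  `LimitsDescribable_of`, both stubs resolved to the sorried theorems (signatures
  `SimpleChordalLimits` / `TargetHeightDivergence`), `sorries` = exactly the two stubs.
* BC3 probes (folder `bc/dprobe_*.lean`; environment = route file + `SimpleCurveLoewner` + the two
  stub STATEMENTS copied verbatim, no sorried stub / composition in scope; battery
  `first | exact? | simpa | simpa [S] | (unfold S; simpa) | aesop` ⊇ `first | exact? | simpa | aesop`,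
  plain AND hypothesis-introduced; positive control `S → S` rc 0): `SimpleChordalLimits →
  LimitsDescribable` FAIL ×2, `SimpleChordalLimits → SAWScalingLimit` FAIL ×2,
  `TargetHeightDivergence → LimitsDescribable` FAIL ×2, `TargetHeightDivergence → SAWScalingLimit`
  FAIL ×2 (rc 1: `exact?`/`simpa` find nothing, `aesop` "made no progress" / unsolved goals).
  Converse probes (recorded, not required) `LimitsDescribable → S`, `SAWScalingLimit → S` FAIL ×4
  mechanically (the summit does imply STUB 1 through the landed necessity chain, not in scope).
  No stub is cheaply the crux or the summit.

Namespace `…Cruxes.LimitsDescribable.Birth`; no new objects — both stub statements are over tree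
declarations only (`CurveClass.simple/source/target/range`, `IsSubseqLimitLaw`, `SAW.law`,
`ConformalEquiv.symm`, `MarkedDomain.IsChordalUniformizing`).
-/

noncomputable section

open MeasureTheory Filter Topology Set Metric Function
open scoped ENNReal NNReal unitInterval BoundedContinuousFunction
open Literature.Probability.RandomPlanarGeometry Literature.Probability.LatticeModels
open UpperHalfPlane (upperHalfPlaneSet)

namespace Summit.CriticalPhenomena.SAWScalingLimit.Cruxes.LimitsDescribable.Birth

/-! ### Stub statements -/

/-- **STUB 1 statement — `SimpleChordalLimits`**: every probability measure `ν` on curve classes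
that is the weak limit, along a sequence of meshes `s n → 0⁺`, of the pushed-forward critical
`δℤ²` SAW laws of `(D; a_δ, b_δ)` is carried by SIMPLE CHORDS of `(D; a, b)`: `ν`-a.e. class is
simple, runs from `a = D.pt 0` to `b = D.pt 1`, has range in `closure D` and meets `∂D` only at
`a, b`.  This is VERBATIM the body of the shared crux `SimpleSubseqLimits`
(stmt-CriticalPhenomena-4982, route `SAWLoopFugacityFlow`; see the wiring `example` at the end of
the file, which feeds that route item into `LimitsDescribable_of` by `rfl`-typing) — not a new
statement: it closes when that item closes. -/
def SimpleChordalLimits : Prop :=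
  ∀ (D : DobrushinDomain) (a b : ℝ → Site 2), SAW.IsEndpointApprox D a b →
    ∀ (s : ℕ → ℝ) (ν : Measure (CurveClass ℂ)), Tendsto s atTop (𝓝[>] (0 : ℝ)) →
      IsProbabilityMeasure ν →
      (∀ f : BoundedContinuousFunction (CurveClass ℂ) ℝ,
        Tendsto (fun n => ∫ γ, f γ.curve ∂(SAW.law D.carrier (s n) (a (s n)) (b (s n)))) atTop
          (𝓝 (∫ x, f x ∂ν))) →
      ∀ᵐ γ ∂ν, γ ∈ CurveClass.simple ∧ γ.source = D.pt 0 ∧ γ.target = D.pt 1 ∧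
        γ.range ⊆ closure D.carrier ∧ γ.range ∩ frontier D.carrier ⊆ {D.pt 0, D.pt 1}

/-- **STUB 2 statement — `TargetHeightDivergence`** (no tangential creep into the target): for
every Dobrushin domain, endpoint approximation, chordal uniformizing map `φ : ℍ → D` (`0 ↦ a`,
`∞ ↦ b`) and every probability subsequential limit `ν` of the SAW curve laws (the antecedent block
of the crux, verbatim), `ν`-a.e. class approaches `b` ONLY THROUGH DIVERGING CONFORMAL HEIGHT: for
every level `M` there is a radius `r > 0` such that every point of the trace inside `D` within
distance `r` of `b` has `im φ⁻¹ > M`.  For a chord ending at `b` this is the hypothesis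
`im φ⁻¹(c(u)) → ∞` (`u ↑ 1`) of Lawler's Prop. 4.4 in the tree's form
(`MarkedDomain.IsChordalUniformizing.isLoewnerDescribable_mk_of_injOn`), i.e. divergence of the
half-plane capacity of the pull-back — the one property of the limit at the TARGET that
Loewner-describability needs beyond simplicity (Kemppainen–Smirnov 2017, Prop. 3.2 (i):
transience `N₀` at `b`, the output of Condition G2 near the target). -/
def TargetHeightDivergence : Prop :=
  ∀ (D : DobrushinDomain) (a b : ℝ → Site 2), SAW.IsEndpointApprox D a b →
    ∀ (φ : ConformalEquiv upperHalfPlaneSet D.carrier), D.IsChordalUniformizing φ →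
      ∀ ν : Measure (CurveClass ℂ), IsProbabilityMeasure ν →
        IsSubseqLimitLaw (fun δ (γ : SAW.DomainSAW D.carrier δ (a δ) (b δ)) => γ.curve)
          (fun δ => SAW.law D.carrier δ (a δ) (b δ)) ν →
        ∀ᵐ c ∂ν, ∀ M : ℝ, ∃ r : ℝ, 0 < r ∧
          ∀ z ∈ c.range, z ∈ D.carrier → dist z (D.pt 1) < r → M < (φ.symm z).im

/-! ### The registered stubs (the ONLY `sorry`s of the file) -/

/-- STUB 1 (open; = stmt-CriticalPhenomena-4982 verbatim, shared and staffed there): subsequential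
limits of the critical SAW are carried by simple chords of `(D; a, b)`. -/
theorem stub_simpleChordalLimits : SimpleChordalLimits := by
  sorry

/-- STUB 2 (open; new, limit-level): no tangential creep into the target — diverging conformal
height at `b`. -/
theorem stub_targetHeightDivergence : TargetHeightDivergence := by
  sorry

/-! ### Name-keyed aliases — the hypotheses of `LimitsDescribable_of`

The native skeleton audit (`#h21_check_skeleton`) admits a hypothesis of the skeleton theorem only
if its head constant is a registered obligation or is NAMED like a declared stub;
`__Registered.stub_X` is the statement of `stub_X` under that name (device of
`Cruxes/EventualTight/Lines/birth.lean`).  Each alias is `rfl`-equal to its statement. -/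
namespace __Registered

/-- Alias of `SimpleChordalLimits` keyed by the registered stub name. -/
abbrev stub_simpleChordalLimits : Prop := SimpleChordalLimits
/-- Alias of `TargetHeightDivergence` keyed by the registered stub name. -/
abbrev stub_targetHeightDivergence : Prop := TargetHeightDivergence

end __Registered

/-! ### Composition (PROVED): stubs ⇒ the crux, by name -/

/-- **The composition.** `stub_simpleChordalLimits → stub_targetHeightDivergence →
LimitsDescribable` (route `SAWLaplacianWalk`, BY NAME).  Given a probability subsequential limit
`ν` along `s n → 0⁺`: STUB 1 gives `ν`-a.e. an injective representative `γ` from `a` to `b` with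
`γ(0, 1) ⊆ D` (a point of `γ(0, 1)` on `∂D` would be `a = γ 0` or `b = γ 1`, contradicting
injectivity); STUB 2 with `γ u → γ 1 = b` gives `im φ⁻¹(γ u) → ∞` as `u ↑ 1`; Lawler's
Prop. 4.4 in the tree (`isLoewnerDescribable_mk_of_injOn`: pull-back, capacity clock,
continuous Loewner transform) gives `IsLoewnerDescribable φ (mk γ)`; the source clause is STUB 1's.
[cite: Lawler2005, §4.1 Prop. 4.4] [cite: KemppainenSmirnov2017, Thm. 1.5 (ii)] -/
theorem LimitsDescribable_of (h1 : __Registered.stub_simpleChordalLimits)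
    (h2 : __Registered.stub_targetHeightDivergence) :
    Summit.CriticalPhenomena.SAWScalingLimit.Theses.SAWLaplacianWalk.LimitsDescribable := by
  intro D a b hab φ hφ ν hν hsub
  obtain ⟨s, hs, hw⟩ := hsub
  have hS := h1 D a b hab s ν hs hν hw
  have hH := h2 D a b hab φ hφ ν hν ⟨s, hs, hw⟩
  filter_upwards [hS, hH] with c hc hh
  obtain ⟨hsimple, hsrc, htgt, hrange, hfront⟩ := hc
  refine ⟨?_, hsrc⟩
  obtain ⟨γ, hγinj, rfl⟩ := hsimple
  -- endpoints of the injective representative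
  have h0 : γ 0 = D.pt 0 := hsrc
  have h1' : γ 1 = D.pt 1 := htgt
  -- the open piece `γ(0, 1)` lies in `D`
  have hin : ∀ u : I, 0 < (u : ℝ) → (u : ℝ) < 1 → γ u ∈ D.carrier := by
    intro u hu0 hu1
    have hcl : γ u ∈ closure D.carrier := hrange ⟨u, rfl⟩
    rw [closure_eq_interior_union_frontier, D.isOpen.interior_eq] at hcl
    rcases hcl with h | h
    · exact h
    · exfalso
      have hmem : γ u ∈ ({D.pt 0, D.pt 1} : Set ℂ) := hfront ⟨⟨u, rfl⟩, h⟩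
      rcases hmem with h' | h'
      · have hu : u = 0 := hγinj (h'.trans h0.symm)
        rw [hu] at hu0
        exact lt_irrefl _ hu0
      · have hu : u = 1 := hγinj (h'.trans h1'.symm)
        rw [hu] at hu1
        exact lt_irrefl _ hu1
  have hinj : InjOn γ {u : I | 0 < (u : ℝ) ∧ (u : ℝ) < 1} := hγinj.injOn
  -- diverging conformal height at the target, along the representative
  have hinf : Tendsto (fun u : ℝ => (φ.symm (IccExtend zero_le_one γ u)).im) (𝓝[<] 1) atTop := by
    rw [Filter.tendsto_atTop]
    intro M
    obtain ⟨r, hr, hM⟩ := hh M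
    have hcont : Continuous (IccExtend zero_le_one (γ : I → ℂ)) := γ.continuous.Icc_extend'
    have h1lim : Tendsto (IccExtend zero_le_one (γ : I → ℂ)) (𝓝[<] (1 : ℝ)) (𝓝 (D.pt 1)) := by
      have h := hcont.tendsto 1
      rw [IccExtend_right] at h
      exact tendsto_nhdsWithin_of_tendsto_nhds (h1' ▸ h)
    have hball : ∀ᶠ u in 𝓝[<] (1 : ℝ), dist (IccExtend zero_le_one (γ : I → ℂ) u) (D.pt 1) < r :=
      (Metric.tendsto_nhds.1 h1lim) r hr
    filter_upwards [hball, Ioo_mem_nhdsLT one_pos] with u hu hu'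
    have hmem : IccExtend zero_le_one (γ : I → ℂ) u = γ ⟨u, hu'.1.le, hu'.2.le⟩ :=
      IccExtend_of_mem zero_le_one γ ⟨hu'.1.le, hu'.2.le⟩
    rw [hmem] at hu ⊢
    exact (hM _ ⟨_, rfl⟩ (hin _ hu'.1 hu'.2) hu).le
  exact hφ.isLoewnerDescribable_mk_of_injOn h0 h1' hin hinj hinf

/-- Wiring check 1: the registered stubs feed `LimitsDescribable_of` as stated (becomes the crux
proof when the two `sorry`s above are discharged). -/
example : Summit.CriticalPhenomena.SAWScalingLimit.Theses.SAWLaplacianWalk.LimitsDescribable :=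
  LimitsDescribable_of stub_simpleChordalLimits stub_targetHeightDivergence

/-- Wiring check 2 (shared crux): the copy `SAWTipEnvironment.LimitsDescribable` of the same item
stmt-CriticalPhenomena-4481 (identical body) follows by the same term. -/
example : Summit.CriticalPhenomena.SAWScalingLimit.Theses.SAWTipEnvironment.LimitsDescribable :=
  LimitsDescribable_of stub_simpleChordalLimits stub_targetHeightDivergence

/-- Wiring check 3 (dedup): STUB 1 IS the route item `SAWLoopFugacityFlow.SimpleSubseqLimits`
(stmt-CriticalPhenomena-4982) — the item itself, by name, feeds the composition. -/
example (hS : Summit.CriticalPhenomena.SAWScalingLimit.Theses.SAWLoopFugacityFlow.SimpleSubseqLimits)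
    (hH : TargetHeightDivergence) :
    Summit.CriticalPhenomena.SAWScalingLimit.Theses.SAWLaplacianWalk.LimitsDescribable :=
  LimitsDescribable_of hS hH

end Summit.CriticalPhenomena.SAWScalingLimit.Cruxes.LimitsDescribable.Birth

end
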